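import Summits.BirchSwinnertonDyer.Rank1Residual.Additive.RamifiedSevenGenusFactorisationShape
import Literature.NumberTheory.ComplexMultiplication.EllipticUnits.KatoEllipticZetaElement
import Literature.NumberTheory.EllipticCurves.ZpExtensionRestrictProofs
import HarnessLib

set_option autoImplicit false

/-!
# `𝒞₇` genus road (crux `EllipticUnitValueSevenOfGZK`, K7r), row (K2C-2) filler (N): THE NUMBER-FIELD COLUMN of the
# pinned-frame existential — `K = ℚ(√−7)` of degree `2`, `√−7 ∈ O_K`, the conductor ideal `𝔣 = (√−7·D)` of norm `7D²`
# dividing `(7D)`, an admissible twist `𝔞 = (m)` of norm `m²` prime to `6·7·𝔣`, and a topological generator `γK` of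
# `Kℚ_∞/K` — stand-alone EXISTENCE theorems (nothing in place is touched; THEOREMS ONLY)

Cell bsd-cm, seat bsd-cm-prr-ty1 g30 (literature-prover), SUMMON `wake/SUMMON-bsd-cm-prr-ty1-20260830T1605Z.md` item (N)
(«for a 𝒞₇ member with genus discriminant `D`, CONSTRUCT the `ℚ(√−7)`-side data `𝔣`, `𝔞`, `γK`/`isTopGenerator_γK` … as
stand-alone existence lemmas `exists_…` in ONE additive file»).  These inhabit the fields (N1) `Kcm`/`finrank_Kcm`/`sqrtNegSeven`,
(N6) `𝔣`/`absNorm_𝔣`/`𝔣_dvd`, (N8) `𝔞`/`isTwist_𝔞`/`absNorm_𝔞` and (λ3) `γK`/`isTopGenerator_γK` of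
`KatoGenusFrame`/`PinnedKatoGenusFrame` ((B1b) p774033, (P1) p776025), each for ANY number field `K` of degree `2` with an
`x`, `x² = −7` (resp. for the concrete `ℚ(√−7) ⊂ ℚ̄`).

## What is here
* `exists_quadraticField_sqrt_negSeven` — `ℚ(√−7) ⊂ ℚ̄`: an intermediate field `F` of `ℚ̄/ℚ` with `finrank ℚ F = 2` and an
  `x : F` with `x² = −7` (`X² + 7` is irreducible over `ℚ` since `−7` is not a rational square; `IntermediateField.adjoin.finrank`).
* `exists_ringOfIntegers_sqrt` — `√−7 ∈ O_K`: an `s : 𝓞 K` with `↑s = x`, `s² = −7` (a root of the monic `X² + 7`).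
* `natAbs_norm_sqrt_negSeven` (`|N(s)| = 7`, from `N(s)² = N(−7) = 49`), `absNorm_span_sqrt_mul` (`N((s·D)) = 7·D²`),
  `span_sqrt_mul_dvd` (`(s·D) ∣ (7D)`, as `7D = (s·D)·(−s)`): the conductor ideal `𝔣 := (√−7·D)` has the two (N6) properties.
* `absNorm_span_natCast` (`N((m)) = m²`), `span_natCast_ne_top` (`m ≥ 2`), `isCoprime_span_natCast_katoModulus6`
  (`gcd(m, 42·7·D) = 1 ⇒ (m) + 6·7·𝔣 = O_K`), `isTwist_span_natCast`: the twist `𝔞 := (m)` is ADMISSIBLE (`IsTwist 7 𝔣 𝔞`,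
  Kato §15.6: prime to `6p𝔣`, `≠ O_K`) of norm `m²`.
* `exists_conductor_and_twist (F : GenusFrame) …` — the (N6)+(N8) package for a genus frame, under the hypothesis
  `F.normA = m²` with `gcd(m, 42·D) = 1`, `m ≥ 2` (see CONSTRAINT).
* `exists_isTopGenerator_γK` — (λ3): a topological generator of `(K.restrictOfFinrankEqTwo _ Kcm _)` exists (the tree's
  `ZpExtension.exists_isTopGenerator_restrictOfFinrankEqTwo` at `p = 7`).

## CONSTRAINT on `F.normA` (for the pen / the K1ᵘ side) and what is NOT here
An ideal of `O_K`, `K = ℚ(√−7)`, of norm `N` exists iff every prime `q ∣ N` inert in `K` (`(−7/q) = −1`, e.g. `q = 3, 5, 13`)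
occurs to an even power; `GenusFrame` only asks `2 ≤ normA`, `gcd(normA, 7D) = 1`, so `∃ 𝔞, absNorm 𝔞 = F.normA` is NOT a
theorem for every frame (`normA = 3` has none).  The lemma here covers `normA = m²` (`𝔞 = (m)`, any `m ≥ 2` prime to `42D`,
e.g. `m = 5` when `5 ∤ D`, else `m = 11`, …); a split prime `q = 𝔮𝔮̄` (`(−7/q) = 1`, e.g. `q = 2, 11, 23`) would serve with
`𝔞 = 𝔮` but needs prime decomposition in `O_K`, not attempted.  NOT here either: (N2) `bad_iff_dvd` (a statement about `W`,
not the number field) and (ii) `isRayClassLayer_layer` («`Kℚ_n ⊂ K(ζ_{7^{n+1}}) ⊂ K(W[7^{n+1}])`»), which needs the Weil-pairing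
containment `K(W[m]) ⊇ K(ζ_m)` — not in the tree; no named fact is introduced for it (debt 0; it stays a field to inhabit).

HONEST LABEL: elementary algebraic number theory; nothing about 19945 is asserted; no summit statement is proved by this seat;
19945 OPEN; `X12.CMRamifiedSeven` NOT proved; BSD is claimed for no curve.

References: K. Kato, Astérisque 295 (2004) §15.5–15.6 (pp. 253–254: "`𝔞` prime to `6p𝔣`, `𝔞 ≠ O_K`"), §15.8 (p. 257: `K =
ℚ(√−N)`, conductor `𝔣`) [Kato2004Asterisque]; J. Neukirch (1999) I §8 (norms of ideals in quadratic fields) [Neukirch1999];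
L. C. Washington (1997) §13.2 (ℤ_p-extensions of a quadratic extension) [Washington1997]; (B1b) p774033, (P1) p776025.
-/

noncomputable section

open scoped NumberField
open NumberField Polynomial IsDedekindDomain
open Literature.NumberTheory.EllipticCurves
open Literature.NumberTheory.ComplexMultiplication.EllipticUnits

namespace Summit.BirchSwinnertonDyer.Rank1Residual.Additive.GenusSeven

/-! ## §1 The field `ℚ(√−7)` and the integer `√−7` -/

/-- **`ℚ(√−7) ⊂ ℚ̄` has degree `2`**: there is an intermediate field `F` of `ℚ̄/ℚ` with `[F : ℚ] = 2` containing a square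
root of `−7` (`F = ℚ(z)`, `z² = −7`, `minpoly z = X² + 7` irreducible as `−7` is not a square in `ℚ`).
[cite: Kato2004Asterisque, §15.8 (p. 257, "K an imaginary quadratic field")] [cite: Neukirch1999, I §2] -/
theorem exists_quadraticField_sqrt_negSeven :
    ∃ F : IntermediateField ℚ (AlgebraicClosure ℚ), Module.finrank ℚ F = 2 ∧ ∃ x : F, x ^ 2 = -7 := by
  obtain ⟨z, hz⟩ := IsAlgClosed.exists_pow_nat_eq (-7 : AlgebraicClosure ℚ) two_pos
  have hirr : Irreducible (X ^ 2 - C (-7 : ℚ)) := by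
    refine X_pow_sub_C_irreducible_of_prime Nat.prime_two ?_
    intro b hb
    have : (0 : ℚ) ≤ b ^ 2 := sq_nonneg b
    linarith
  have h7 : IsIntegral ℚ (-7 : AlgebraicClosure ℚ) := by
    have : IsIntegral ℚ (algebraMap ℚ (AlgebraicClosure ℚ) (-7)) := isIntegral_algebraMap
    simpa using this
  have hint : IsIntegral ℚ z := IsIntegral.of_pow two_pos (by rw [hz]; exact h7)
  have hmin : minpoly ℚ z = X ^ 2 - C (-7 : ℚ) := by
    refine (minpoly.eq_of_irreducible_of_monic hirr ?_ (monic_X_pow_sub_C _ two_ne_zero)).symm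
    simp [hz]
  refine ⟨IntermediateField.adjoin ℚ {z}, ?_, ⟨⟨z, IntermediateField.mem_adjoin_simple_self ℚ z⟩, ?_⟩⟩
  · rw [IntermediateField.adjoin.finrank hint, hmin, natDegree_X_pow_sub_C]
  · exact Subtype.ext hz

variable {K : Type} [Field K]

/-- **`√−7 ∈ O_K`**: a square root of `−7` in a number field is an algebraic integer (root of the monic `X² + 7`).
[cite: Neukirch1999, I §2 (algebraic integers)] -/
theorem exists_ringOfIntegers_sqrt (x : K) (hx : x ^ 2 = -7) : ∃ s : 𝓞 K, (s : K) = x ∧ s ^ 2 = -7 := by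
  have h7 : IsIntegral ℤ (-7 : K) := by
    have : IsIntegral ℤ (algebraMap ℤ K (-7)) := isIntegral_algebraMap
    simpa using this
  have hint : IsIntegral ℤ x := IsIntegral.of_pow two_pos (by rw [hx]; exact h7)
  refine ⟨⟨x, (mem_integralClosure_iff (R := ℤ) (A := K)).mpr hint⟩, rfl, ?_⟩
  apply RingOfIntegers.coe_injective
  push_cast
  exact hx

/-! ## §2 The conductor ideal `𝔣 = (√−7·D)`: norm `7D²`, divides `(7D)` -/

variable [NumberField K]

/-- `|N_{K/ℚ}(s)| = 7` for `s ∈ O_K`, `s² = −7`, `[K : ℚ] = 2` (`N(s)² = N(s²) = N(−7) = 49`).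
[cite: Neukirch1999, I §2 and I §8] -/
theorem natAbs_norm_sqrt_negSeven (h2 : Module.finrank ℚ K = 2) (s : 𝓞 K) (hs : s ^ 2 = -7) :
    (Algebra.norm ℤ s).natAbs = 7 := by
  have hrank : Module.finrank ℤ (𝓞 K) = 2 := by rw [RingOfIntegers.rank, h2]
  have h1 : (Algebra.norm ℤ s) ^ 2 = 49 := by
    rw [← map_pow, hs, show (-7 : 𝓞 K) = algebraMap ℤ (𝓞 K) (-7) by simp, Algebra.norm_algebraMap, hrank]
    norm_num
  have h3 : ((Algebra.norm ℤ s).natAbs) ^ 2 = 7 ^ 2 := by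
    zify; rw [sq_abs]; exact_mod_cast h1
  exact Nat.pow_left_injective two_ne_zero h3

/-- **`N((√−7·D)) = 7·D²`** (`[K : ℚ] = 2`). [cite: Kato2004Asterisque, §15.8 (p. 257)] [cite: Neukirch1999, I §8] -/
theorem absNorm_span_sqrt_mul (h2 : Module.finrank ℚ K = 2) (s : 𝓞 K) (hs : s ^ 2 = -7) (D : ℤ) :
    Ideal.absNorm (Ideal.span {s * (D : 𝓞 K)}) = 7 * D.natAbs ^ 2 := by
  have hrank : Module.finrank ℤ (𝓞 K) = 2 := by rw [RingOfIntegers.rank, h2]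
  rw [Ideal.absNorm_span_singleton, map_mul, Int.natAbs_mul, natAbs_norm_sqrt_negSeven h2 s hs,
    show ((D : 𝓞 K)) = algebraMap ℤ (𝓞 K) D by simp, Algebra.norm_algebraMap, hrank, Int.natAbs_pow]

/-- **`(√−7·D) ∣ (7D)`** (`7D = (√−7·D)·(−√−7)`). [cite: Kato2004Asterisque, §15.8 (p. 257, "cond ψ ∣ 𝔣")] -/
theorem span_sqrt_mul_dvd (s : 𝓞 K) (hs : s ^ 2 = -7) (D : ℤ) :
    Ideal.span {s * (D : 𝓞 K)} ∣ Ideal.span {((7 * D : ℤ) : 𝓞 K)} := by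
  rw [Ideal.dvd_span_singleton, Ideal.mem_span_singleton]
  refine ⟨-s, ?_⟩
  have : s * (D : 𝓞 K) * -s = -(s ^ 2) * D := by ring
  rw [this, hs]; push_cast; ring

/-! ## §3 The admissible twist `𝔞 = (m)`: norm `m²`, prime to `6·7·𝔣`, `≠ O_K` -/

/-- **`N((m)) = m²`** for `m ∈ ℕ` (`[K : ℚ] = 2`). [cite: Neukirch1999, I §8] -/
theorem absNorm_span_natCast (h2 : Module.finrank ℚ K = 2) (m : ℕ) :
    Ideal.absNorm (Ideal.span {((m : 𝓞 K))}) = m ^ 2 := by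
  have hrank : Module.finrank ℤ (𝓞 K) = 2 := by rw [RingOfIntegers.rank, h2]
  rw [Ideal.absNorm_span_singleton, show ((m : 𝓞 K)) = algebraMap ℤ (𝓞 K) m by simp, Algebra.norm_algebraMap,
    hrank, Int.natAbs_pow, Int.natAbs_natCast]

/-- `(m) ≠ O_K` for `m ≥ 2` (its norm is `m² ≥ 4`). [cite: Kato2004Asterisque, §15.6 (p. 254, "𝔞 ≠ O_K")] -/
theorem span_natCast_ne_top (h2 : Module.finrank ℚ K = 2) {m : ℕ} (hm : 2 ≤ m) :
    Ideal.span {((m : 𝓞 K))} ≠ ⊤ := by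
  intro h
  have h1 := absNorm_span_natCast (K := K) h2 m
  rw [h, Ideal.absNorm_top] at h1
  have : 4 ≤ m ^ 2 := by nlinarith
  omega

omit [NumberField K] in
/-- **`(m)` is prime to `6·7·𝔣`**, `𝔣 = (√−7·D)`, when `gcd(m, 42·7·D) = 1` (Bézout in `ℤ`, read in `O_K`; `42·7·D =
(42·√−7·D)·(−√−7)`). [cite: Kato2004Asterisque, §15.5–15.6 (pp. 253–254, "prime to 6p𝔣")] -/
theorem isCoprime_span_natCast_katoModulus6 (s : 𝓞 K) (hs : s ^ 2 = -7) (D : ℤ) {m : ℕ}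
    (hm : m.Coprime (42 * 7 * D.natAbs)) :
    IsCoprime (Ideal.span {((m : 𝓞 K))}) (katoModulus6 7 (Ideal.span {s * (D : 𝓞 K)})) := by
  rw [katoModulus6, Ideal.span_singleton_mul_span_singleton, Ideal.isCoprime_span_singleton_iff]
  have hz : IsCoprime (m : ℤ) (42 * 7 * D) := by
    rw [Int.isCoprime_iff_gcd_eq_one]
    have := hm
    rw [Nat.Coprime] at this
    rw [Int.gcd_eq_natAbs]
    simpa [Int.natAbs_mul] using this
  have h1 : IsCoprime ((m : 𝓞 K)) (((42 * 7 * D : ℤ) : 𝓞 K)) := by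
    have := hz.map (Int.castRingHom (𝓞 K))
    simpa using this
  have h42 : ((42 * 7 * D : ℤ) : 𝓞 K) = ((6 * 7 : ℕ) : 𝓞 K) * (s * (D : 𝓞 K)) * (-s) := by
    have : ((6 * 7 : ℕ) : 𝓞 K) * (s * (D : 𝓞 K)) * (-s) = -(s ^ 2) * (42 * D) := by push_cast; ring
    rw [this, hs]; push_cast; ring
  rw [h42] at h1
  exact h1.of_mul_right_left

/-- **`𝔞 = (m)` is an ADMISSIBLE TWIST** for `𝔣 = (√−7·D)`: `IsTwist 7 𝔣 (m)` for `m ≥ 2` prime to `42·7·D`.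
[cite: Kato2004Asterisque, §15.6 (p. 254, "𝔞 is any ideal of O_K which is prime to 6p𝔣 such that 𝔞 ≠ O_K")] -/
theorem isTwist_span_natCast (h2 : Module.finrank ℚ K = 2) (s : 𝓞 K) (hs : s ^ 2 = -7) (D : ℤ) {m : ℕ}
    (hm2 : 2 ≤ m) (hm : m.Coprime (42 * 7 * D.natAbs)) :
    IsTwist 7 (Ideal.span {s * (D : 𝓞 K)}) (Ideal.span {((m : 𝓞 K))}) :=
  ⟨isCoprime_span_natCast_katoModulus6 s hs D hm, span_natCast_ne_top h2 hm2⟩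

/-! ## §4 The packages for a genus frame and the generator `γK` -/

/-- **(N6)+(N8) for a genus frame `F`** over any degree-`2` number field `K` with `x² = −7`: a conductor ideal `𝔣` with
`absNorm 𝔣 = 7·F.d²`, `𝔣 ∣ (7·F.D)`, and — PROVIDED `F.normA = m²` with `m ≥ 2`, `gcd(m, 42·F.d) = 1` (module docstring
CONSTRAINT) — an admissible twist `𝔞` with `absNorm 𝔞 = F.normA`.  Witnesses: `𝔣 = (√−7·D)`, `𝔞 = (m)`.
[cite: Kato2004Asterisque, §15.6 (p. 254) and §15.8 (p. 257)] -/
theorem exists_conductor_and_twist (F : GenusFrame) (h2 : Module.finrank ℚ K = 2) (x : K) (hx : x ^ 2 = -7)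
    {m : ℕ} (hm2 : 2 ≤ m) (hm : m.Coprime (42 * F.d)) (hA : F.normA = m ^ 2) :
    ∃ 𝔣 𝔞 : Ideal (𝓞 K), Ideal.absNorm 𝔣 = 7 * F.d ^ 2 ∧ 𝔣 ∣ Ideal.span {((7 * F.D : ℤ) : 𝓞 K)} ∧
      IsTwist 7 𝔣 𝔞 ∧ Ideal.absNorm 𝔞 = F.normA := by
  obtain ⟨s, -, hs⟩ := exists_ringOfIntegers_sqrt x hx
  have hm' : m.Coprime (42 * 7 * F.D.natAbs) := by
    have h7 : m.Coprime 7 := by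
      have hA7 : F.normA.Coprime 7 := (Nat.Coprime.coprime_mul_right_right F.normA_coprime)
      rw [hA] at hA7
      exact (Nat.coprime_pow_left_iff (by norm_num : 0 < 2) _ _).mp hA7
    have : m.Coprime (42 * F.d * 7) := Nat.Coprime.mul_right hm h7
    simpa [GenusFrame.d, mul_comm, mul_assoc, mul_left_comm] using this
  exact ⟨Ideal.span {s * (F.D : 𝓞 K)}, Ideal.span {((m : 𝓞 K))}, absNorm_span_sqrt_mul h2 s hs F.D,
    span_sqrt_mul_dvd s hs F.D, isTwist_span_natCast h2 s hs F.D hm2 hm', by rw [absNorm_span_natCast h2, hA]⟩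

/-- **(λ3) a topological generator `γK` of `Kℚ_∞/K`** for the CM field (`[Kcm : ℚ] = 2`, `7 ≠ 2`): the tree's
`ZpExtension.exists_isTopGenerator_restrictOfFinrankEqTwo` at `p = 7`, in the frame's exact typing.
[cite: Washington1997, §13.2] -/
theorem exists_isTopGenerator_γK (K : ZpExtension ℚ 7) (Kcm : Type) [Field Kcm] [NumberField Kcm]
    (hKcm : Module.finrank ℚ Kcm = 2) :
    ∃ γK : Field.absoluteGaloisGroup Kcm, (K.restrictOfFinrankEqTwo (by decide) Kcm hKcm).IsTopGenerator γK :=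
  ZpExtension.exists_isTopGenerator_restrictOfFinrankEqTwo (by decide) K Kcm hKcm

end Summit.BirchSwinnertonDyer.Rank1Residual.Additive.GenusSeven

end
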